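import Literature.RingTheory.SymmetricFunctions.SchurPolynomials
import HarnessLib

/-!
# Cauchy's identity, analytic form: absolutely convergent Schur and Shintani-pair series

Topic `RingTheory/SymmetricFunctions`; namespace `Literature.SymmPoly`. Sequel to `SchurPolynomials`:
the formal identities of that file in `R⟦T⟧` are turned into absolutely convergent sums over a
complete normed field `𝕜` (everything proved, Mathlib + `SchurPolynomials` only).

* `summable_norm_coeff_prod_and_hasSum`: if finitely many power series `f_i ∈ 𝕜⟦T⟧` have
  absolutely summable coefficient sequences with sums `a_i`, then so does `∏_i f_i`, with sum
  `∏_i a_i` (iterated Mertens/Cauchy product, Mathlib's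
  `tsum_mul_tsum_eq_tsum_sum_antidiagonal_of_summable_norm`);
* `cauchySeries_eq_prod_geom`: `∑_λ s_λ(x) s_λ(y) T^{|λ|} = ∏_{i,j} ∑_m (x_i y_j)^m T^m` in
  `R⟦T⟧` (from `cauchySeries_mul_cauchyProd`);
* `hasSum_coeff_cauchySeries_mul_pow` (**Cauchy's identity, analytic**): for `‖x_i y_j t‖ < 1`,
  `∑_N (∑_{λ antitone, |λ|=N} s_λ(x) s_λ(y)) t^N = ∏_{i,j} (1 - x_i y_j t)⁻¹`, absolutely
  (`summable_norm_coeff_cauchySeries_mul_pow`) — Macdonald, *Symmetric functions and Hall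
  polynomials*, Ch. I (4.3), at a point;
* `mk_sum_mul_eq_C_mul_cauchySeries`, `hasSum_shintaniPair`, `summable_norm_shintaniPair`: for
  a pair `w, w'` of solutions of the dual Pieri recursions for `x, y` (vanishing off the antitone
  weights; `eq_schur_smul_of_pieri`), `∑_N (∑_{|m|=N} w(m) w'(m)) t^N =
  w(0) w'(0) ∏_{i,j} (1 - x_i y_j t)⁻¹` for `‖x_i y_j t‖ < 1`. With `x, y` the Satake parameters
  of two unramified representations of `GL_n(F)`, `t = q^{-s}` and `w, w'` the normalised
  spherical Whittaker functions on the dominant torus elements (Shintani 1976), this is the value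
  `Ψ(s; W°, W'°, 𝟙_{𝒪ⁿ}) = W°(1) W'°(1) det(1 - q^{-s} A ⊗ A')⁻¹` of the unramified local
  Rankin–Selberg integral (Jacquet–Shalika, Amer. J. Math. 103 (1981), §2; Cogdell, Fields
  Institute lectures, Thm. 3.3) *after* the `p`-adic integral has been unfolded to the torus
  sum — the unfolding (Iwasawa decomposition, the Hecke double-coset transversal, the conductor
  of `ψ`) is not in this file.

## References

* I. G. Macdonald, *Symmetric Functions and Hall Polynomials*, 2nd ed. (1995), Ch. I (4.3).
* T. Shintani, Proc. Japan Acad. 52 (1976), 180–182.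
* H. Jacquet, J. A. Shalika, Amer. J. Math. 103 (1981), 499–558, §2.
-/

noncomputable section

/-! ### From the formal Cauchy identity to absolutely convergent sums -/

namespace Literature.RingTheory.SymmetricFunctions.SymmPoly

open Finset PowerSeries

variable {𝕜 : Type*} [NormedField 𝕜] [CompleteSpace 𝕜]

/-- **Finite Cauchy products, coefficientwise.** If the coefficient sequences of finitely many
power series `f_i ∈ 𝕜⟦T⟧` are absolutely summable with sums `a_i`, then the coefficient sequence
of `∏_i f_i` is absolutely summable with sum `∏_i a_i` (evaluation at `T = 1` is multiplicative on
absolutely convergent series; Mertens/Cauchy product, Mathlib's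
`tsum_mul_tsum_eq_tsum_sum_antidiagonal_of_summable_norm`, iterated). [folklore] -/
theorem summable_norm_coeff_prod_and_hasSum {ι : Type*} [DecidableEq ι] (s : Finset ι)
    (f : ι → 𝕜⟦X⟧) (a : ι → 𝕜) (hsum : ∀ i ∈ s, Summable fun N => ‖coeff N (f i)‖)
    (hval : ∀ i ∈ s, HasSum (fun N => coeff N (f i)) (a i)) :
    (Summable fun N => ‖coeff N (∏ i ∈ s, f i)‖) ∧
      HasSum (fun N => coeff N (∏ i ∈ s, f i)) (∏ i ∈ s, a i) := by
  induction s using Finset.induction_on with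
  | empty =>
    simp only [Finset.prod_empty, coeff_one]
    refine ⟨summable_of_ne_finset_zero (s := {0}) fun N hN => ?_, hasSum_ite_eq 0 1⟩
    rw [Finset.mem_singleton] at hN
    simp [hN]
  | insert i s hi ih =>
    obtain ⟨ihs, ihv⟩ := ih (fun j hj => hsum j (Finset.mem_insert_of_mem hj))
      (fun j hj => hval j (Finset.mem_insert_of_mem hj))
    have hfi := hsum i (Finset.mem_insert_self i s)
    have hvi := hval i (Finset.mem_insert_self i s)
    rw [Finset.prod_insert hi, Finset.prod_insert hi]
    simp_rw [PowerSeries.coeff_mul]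
    set F : ℕ → 𝕜 := fun N => coeff N (f i) with hF
    set G : ℕ → 𝕜 := fun N => coeff N (∏ j ∈ s, f j) with hG
    have h1 : Summable fun N => ‖∑ kl ∈ antidiagonal N, F kl.1 * G kl.2‖ :=
      summable_norm_sum_mul_antidiagonal_of_summable_norm (f := F) (g := G) hfi ihs
    have hs' : Summable fun N => ∑ kl ∈ antidiagonal N, F kl.1 * G kl.2 :=
      summable_sum_mul_antidiagonal_of_summable_norm' (f := F) (g := G) hfi hfi.of_norm ihs
        ihs.of_norm
    have key : (∑' N, F N) * (∑' N, G N) = ∑' N, ∑ kl ∈ antidiagonal N, F kl.1 * G kl.2 :=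
      tsum_mul_tsum_eq_tsum_sum_antidiagonal_of_summable_norm (f := F) (g := G) hfi ihs
    rw [hvi.tsum_eq, ihv.tsum_eq] at key
    refine ⟨h1, ?_⟩
    rw [key]
    exact hs'.hasSum

omit [CompleteSpace 𝕜] in
/-- The geometric series `∑ c^N T^N` has absolutely summable coefficients with sum `(1 - c)⁻¹`
when `‖c‖ < 1`. [folklore] -/
theorem summable_norm_coeff_geom_and_hasSum {c : 𝕜} (hc : ‖c‖ < 1) :
    (Summable fun N => ‖coeff N (geom c)‖) ∧ HasSum (fun N => coeff N (geom c)) (1 - c)⁻¹ := by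
  simp only [coeff_geom, norm_pow]
  exact ⟨summable_geometric_of_lt_one (norm_nonneg _) hc, hasSum_geometric_of_norm_lt_one hc⟩

/-- `Z_{x,y}(T) = ∏_{i,j} ∑_m (x_i y_j)^m T^m` in `R⟦T⟧`: the Cauchy kernel series is the product
of the geometric series (both are inverse to `∏_{i,j}(1 - x_i y_j T)`). [folklore] -/
theorem cauchySeries_eq_prod_geom {R : Type*} [CommRing R] {n : ℕ} (x y : Fin n → R) :
    cauchySeries x y = ∏ i, ∏ j, geom (x i * y j) := by
  have h1 : cauchyProd x y * ∏ i, ∏ j, geom (x i * y j) = 1 := by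
    unfold cauchyProd
    rw [← Finset.prod_mul_distrib]
    refine Finset.prod_eq_one fun i _ => ?_
    rw [← Finset.prod_mul_distrib]
    refine Finset.prod_eq_one fun j _ => ?_
    rw [mul_comm, geom_mul_one_sub]
  calc cauchySeries x y = cauchySeries x y * (cauchyProd x y * ∏ i, ∏ j, geom (x i * y j)) := by
        rw [h1, mul_one]
    _ = ∏ i, ∏ j, geom (x i * y j) := by
        rw [← mul_assoc, cauchySeries_mul_cauchyProd, one_mul]

/-- Rescaling the geometric series: `∑ c^N (tT)^N = ∑ (ct)^N T^N`. [folklore] -/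
theorem rescale_geom {R : Type*} [CommRing R] (c t : R) : rescale t (geom c) = geom (c * t) := by
  ext N
  simp [coeff_rescale, mul_pow, mul_comm]

/-- `Z_{x,y}(T)` as a product of geometric series indexed by pairs. [folklore] -/
theorem cauchySeries_eq_prod_geom_pair {R : Type*} [CommRing R] {n : ℕ} (x y : Fin n → R) :
    cauchySeries x y = ∏ p : Fin n × Fin n, geom (x p.1 * y p.2) := by
  rw [cauchySeries_eq_prod_geom, ← Finset.univ_product_univ, Finset.prod_product]

/-- `[T^N] Z_{x,y} · t^N = [T^N] ∏_{(i,j)} ∑_m (x_i y_j t)^m T^m`. [folklore] -/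
theorem coeff_cauchySeries_mul_pow {R : Type*} [CommRing R] {n : ℕ} (x y : Fin n → R) (t : R)
    (N : ℕ) :
    coeff N (cauchySeries x y) * t ^ N =
      coeff N (∏ p : Fin n × Fin n, geom (x p.1 * y p.2 * t)) := by
  rw [mul_comm, ← coeff_rescale, cauchySeries_eq_prod_geom_pair, map_prod]
  simp_rw [rescale_geom]

/-- **Cauchy's identity, analytic form.** For `x, y ∈ 𝕜ⁿ` and `t ∈ 𝕜` with `‖x_i y_j t‖ < 1`
for all `i, j` (`𝕜` a complete normed field), the series `∑_N (∑_{λ antitone, |λ| = N}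
s_λ(x) s_λ(y)) t^N` converges (absolutely) to `∏_{i,j} (1 - x_i y_j t)⁻¹`
(Macdonald 1995, Ch. I (4.3), specialised). [cite: Macdonald1995, Ch. I (4.3)] -/
theorem hasSum_coeff_cauchySeries_mul_pow {n : ℕ} (x y : Fin n → 𝕜) {t : 𝕜}
    (ht : ∀ i j, ‖x i * y j * t‖ < 1) :
    HasSum (fun N => coeff N (cauchySeries x y) * t ^ N) (∏ i, ∏ j, (1 - x i * y j * t)⁻¹) := by
  classical
  simp_rw [coeff_cauchySeries_mul_pow]
  have e : ∏ i, ∏ j, (1 - x i * y j * t)⁻¹ = ∏ p : Fin n × Fin n, (1 - x p.1 * y p.2 * t)⁻¹ := by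
    rw [← Finset.univ_product_univ, Finset.prod_product]
  rw [e]
  exact (summable_norm_coeff_prod_and_hasSum (univ : Finset (Fin n × Fin n))
    (fun p => geom (x p.1 * y p.2 * t)) (fun p => (1 - x p.1 * y p.2 * t)⁻¹)
    (fun p _ => (summable_norm_coeff_geom_and_hasSum (ht p.1 p.2)).1)
    (fun p _ => (summable_norm_coeff_geom_and_hasSum (ht p.1 p.2)).2)).2

/-- Absolute convergence in `hasSum_coeff_cauchySeries_mul_pow`. [folklore] -/
theorem summable_norm_coeff_cauchySeries_mul_pow {n : ℕ} (x y : Fin n → 𝕜) {t : 𝕜}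
    (ht : ∀ i j, ‖x i * y j * t‖ < 1) :
    Summable fun N => ‖coeff N (cauchySeries x y) * t ^ N‖ := by
  classical
  simp_rw [coeff_cauchySeries_mul_pow]
  exact (summable_norm_coeff_prod_and_hasSum (univ : Finset (Fin n × Fin n))
    (fun p => geom (x p.1 * y p.2 * t)) (fun p => (1 - x p.1 * y p.2 * t)⁻¹)
    (fun p _ => (summable_norm_coeff_geom_and_hasSum (ht p.1 p.2)).1)
    (fun p _ => (summable_norm_coeff_geom_and_hasSum (ht p.1 p.2)).2)).1

/-- The generating series of `w(m) w'(m)` for a pair of solutions of the dual Pieri recursions is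
`w(0) w'(0) Z_{x,y}(T)`. [folklore] -/
theorem mk_sum_mul_eq_C_mul_cauchySeries {R : Type*} [CommRing R] {n : ℕ} (x y : Fin n → R)
    (w w' : (Fin n → ℕ) → R)
    (h0 : ∀ ν, ¬ Antitone ν → w ν = 0)
    (hrec : ∀ la, Antitone la → ∀ r, 1 ≤ r → r ≤ n →
      esymm x r * w la = ∑ S ∈ powersetCard r univ, w (addOn S la))
    (h0' : ∀ ν, ¬ Antitone ν → w' ν = 0)
    (hrec' : ∀ la, Antitone la → ∀ r, 1 ≤ r → r ≤ n →
      esymm y r * w' la = ∑ S ∈ powersetCard r univ, w' (addOn S la)) :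
    (PowerSeries.mk fun N => ∑ m ∈ piAntidiag univ N, w m * w' m) =
      C (w 0 * w' 0) * cauchySeries x y := by
  calc (PowerSeries.mk fun N => ∑ m ∈ piAntidiag univ N, w m * w' m)
      = (PowerSeries.mk fun N => ∑ m ∈ piAntidiag univ N, w m * w' m) *
          (cauchySeries x y * cauchyProd x y) := by rw [cauchySeries_mul_cauchyProd, mul_one]
    _ = C (w 0 * w' 0) * cauchySeries x y := by
        rw [mul_comm (cauchySeries x y), ← mul_assoc,
          mk_sum_mul_mul_cauchyProd x y w w' h0 hrec h0' hrec']

/-- **The unramified Rankin–Selberg sum, analytic form.** For a pair `w, w'` of solutions of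
the dual Pieri recursions for `x, y ∈ 𝕜ⁿ` (vanishing off the antitone weights) and `t ∈ 𝕜` with
`‖x_i y_j t‖ < 1`: `∑_N (∑_{|m| = N} w(m) w'(m)) t^N = w(0) w'(0) ∏_{i,j} (1 - x_i y_j t)⁻¹`,
the series converging absolutely. With `x = ` Satake parameters of `π_v`, `y = ` those of
`π'_v`, `t = q_v^{-s}` and `w, w'` the normalised spherical Whittaker functions on the torus, this
is `Ψ(s; W, W', 𝟙) = W(1) W'(1) det(1 - q^{-s} A ⊗ A')⁻¹` (Jacquet–Shalika 1981, §2;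
Cogdell, Thm. 3.3) once the `p`-adic integral has been unfolded to the sum. [folklore] -/
theorem hasSum_shintaniPair {n : ℕ} (x y : Fin n → 𝕜) (w w' : (Fin n → ℕ) → 𝕜)
    (h0 : ∀ ν, ¬ Antitone ν → w ν = 0)
    (hrec : ∀ la, Antitone la → ∀ r, 1 ≤ r → r ≤ n →
      esymm x r * w la = ∑ S ∈ powersetCard r univ, w (addOn S la))
    (h0' : ∀ ν, ¬ Antitone ν → w' ν = 0)
    (hrec' : ∀ la, Antitone la → ∀ r, 1 ≤ r → r ≤ n →
      esymm y r * w' la = ∑ S ∈ powersetCard r univ, w' (addOn S la))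
    {t : 𝕜} (ht : ∀ i j, ‖x i * y j * t‖ < 1) :
    HasSum (fun N => (∑ m ∈ piAntidiag univ N, w m * w' m) * t ^ N)
      (w 0 * w' 0 * ∏ i, ∏ j, (1 - x i * y j * t)⁻¹) := by
  have h := (hasSum_coeff_cauchySeries_mul_pow x y ht).mul_left (w 0 * w' 0)
  have hfun : (fun N => (∑ m ∈ piAntidiag univ N, w m * w' m) * t ^ N) =
      fun N => w 0 * w' 0 * (coeff N (cauchySeries x y) * t ^ N) := by
    funext N
    have := congrArg (coeff N) (mk_sum_mul_eq_C_mul_cauchySeries x y w w' h0 hrec h0' hrec')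
    rw [coeff_mk, PowerSeries.coeff_C_mul] at this
    rw [this, mul_assoc]
  rw [hfun]
  exact h

/-- Absolute convergence in `hasSum_shintaniPair`. [folklore] -/
theorem summable_norm_shintaniPair {n : ℕ} (x y : Fin n → 𝕜) (w w' : (Fin n → ℕ) → 𝕜)
    (h0 : ∀ ν, ¬ Antitone ν → w ν = 0)
    (hrec : ∀ la, Antitone la → ∀ r, 1 ≤ r → r ≤ n →
      esymm x r * w la = ∑ S ∈ powersetCard r univ, w (addOn S la))
    (h0' : ∀ ν, ¬ Antitone ν → w' ν = 0)
    (hrec' : ∀ la, Antitone la → ∀ r, 1 ≤ r → r ≤ n →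
      esymm y r * w' la = ∑ S ∈ powersetCard r univ, w' (addOn S la))
    {t : 𝕜} (ht : ∀ i j, ‖x i * y j * t‖ < 1) :
    Summable fun N => ‖(∑ m ∈ piAntidiag univ N, w m * w' m) * t ^ N‖ := by
  have h := (summable_norm_coeff_cauchySeries_mul_pow x y ht).mul_left ‖w 0 * w' 0‖
  refine h.of_nonneg_of_le (fun N => norm_nonneg _) fun N => ?_
  have := congrArg (coeff N) (mk_sum_mul_eq_C_mul_cauchySeries x y w w' h0 hrec h0' hrec')
  rw [coeff_mk, PowerSeries.coeff_C_mul] at this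
  rw [this, mul_assoc, norm_mul]

end Literature.RingTheory.SymmetricFunctions.SymmPoly
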